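import Summits.BirchSwinnertonDyer.BirchSwinnertonDyer.Theorems.PrintCf2RamifiedOffTYZLowerHalfVisibleSeven
import HarnessLib

/-!
# Crux workfile (line `offtyz-v7`, crux stmt-BirchSwinnertonDyer-20509) — TURNKEY ASIDE TEXT «RamifiedLowerHalfVisibleSevenOfFacts»
# (LEAD cruxlead-20509 g16, cycle 17): the by-name text of the lower half of C⁺ on the VISIBLE special generators of the block-free family,
# kernel-checked against the landed closer `LowerHalfVisible.two_dvd_scriptL_of_visible_of_facts` (p760160).

For the planner (route-A edit): paste the `def … : Prop :=` body below VERBATIM as `RamifiedLowerHalfVisibleSevenOfFacts` (or any name) into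
`Theses/PrintCf2.lean`; the 3-line closer is
`theorem ramifiedLowerHalfVisibleSevenOfFacts_proof : …Theses.PrintCf2.RamifiedLowerHalfVisibleSevenOfFacts := by
   unfold …RamifiedLowerHalfVisibleSevenOfFacts; exact Summit.BirchSwinnertonDyer.PrintCf2.LowerHalfVisible.two_dvd_scriptL_of_visible_of_facts`.
Literature input of the aside: `tyz_cmPointCompositumData` (`TianYuanZhang2017/CMPointCompositumDisplays.lean`, p759295; refines
`tyz_cmPointRingClassFrobeniusValueData₂`) and GZK.  Nothing is asserted here beyond the `example`s; BSD is not proved by any of this.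
-/

noncomputable section

open WeierstrassCurve WeierstrassCurve.Affine Literature.NumberTheory.EllipticCurves
  Literature.NumberTheory.EllipticCurves.TianYuanZhang2017

namespace Summit.BirchSwinnertonDyer.PrintCf2.VisibleSevenAside

/-- The aside text (A_n = `(congruentNumberCurve n).twoIsogenyCodomain : Y² = X³ + 4n²X`; «generator modulo torsion» as in aside 23304;
«visible» = `X ∉ ℚ² ∪ 2ℚ²`, i.e. descent class `d(h) ∉ {1, 2}`). [cite: TianYuanZhang2017, §1 (p0002 L101–L110), §3.1 (p0011 L58–L66), Thm. 3.5] -/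
def RamifiedLowerHalfVisibleSevenOfFactsText : Prop :=
  (tyz_cmPointCompositumData ∧ rank_eq_analyticRank_of_analyticRank_le_one) →
    ∀ n : ℕ, (hsq : Squarefree n) → n % 8 = 7 → (∀ d ∈ n.divisors, d % 8 ≠ 5) →
      (haveI := isElliptic_congruentNumberCurve hsq.ne_zero; (congruentNumberCurve n).analyticRank = 1) →
      ∀ (X Y : ℚ) (h : ((congruentNumberCurve n).twoIsogenyCodomain).toAffine.Nonsingular X Y),
        (∀ P, ∃ m : ℤ, IsOfFinAddOrder
            (P - m • (Point.some X Y h : ((congruentNumberCurve n).twoIsogenyCodomain).toAffine.Point))) →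
        (¬ ∃ q : ℚ, X = q ^ 2 ∨ X = 2 * q ^ 2) →
          ∀ L : ℤ, IsScriptL n L → (2 : ℤ) ∣ L

/-- The text is closed by the landed theorem (p760160). [cite: TianYuanZhang2017, Thm. 3.5] -/
example : RamifiedLowerHalfVisibleSevenOfFactsText :=
  Summit.BirchSwinnertonDyer.PrintCf2.LowerHalfVisible.two_dvd_scriptL_of_visible_of_facts

end Summit.BirchSwinnertonDyer.PrintCf2.VisibleSevenAside

end
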